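import Summits.Ventures.AbcSig.Rows.Bridge
import Summits.Ventures.AbcSig.Rows.C2aL197A6Q
import Summits.Ventures.AbcSig.Rows.C2aL197A6QAB

/-!
# Venture AbcSig — CELL `C2aL197A6`: the census statement `Rows.C2aCellRed 197 (fun a => 6 ≤ a) ∅` from the two row theorems

Q-VARIANT (p-lean g6 `gen6/spatch2.py`) of `xcell_C2aL197A6`: kernel sieve discharges (q = 2 rule, one extra named hypothesis hQ : M.Q2Package) replace the cited pair(s) 197.1 @ 11 (see the row file(s) `Rows/C2aL197A6Q.lean`, `Rows/C2aL197A6QAB.lean`).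
HONEST FRAMING. COMPUTATION cell `pub-abcsig`; CONDITIONAL theorem; no claim on ABC or any summit. Hypotheses exactly as
in `Rows/C2aL197A6X.lean` and `Rows/C2aL197A6XAB.lean`: `BS04Package` (CITED), `DataComplete …` (COMPUTED level files), `EisPackage` (CITED) and `Refines` (COMPUTED) for the M6 orbits discharged in the kernel, and the
rows' per-orbit exclusions for BOTH family predicates (`famB`, `famAB`) as universally quantified hypotheses (CITED: the census
row's certificates). Conclusion = p1's census predicate (`Rows/Statements.lean`), all four coprime coefficient
distributions `A·B = 2^a·197^m`, reduced exponents `a < n`, `m < n` (RULING H1). GENERATED by p-lean g2 gen/make_rows.py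
(after plean/make_cell_bridges.py).
-/

namespace Summit.Ventures.AbcSig

/-- Cell `C2aL197A6` (M6 orbits discharged in the kernel): `Rows.C2aCellRed 197 (fun a => 6 ≤ a) ∅` under the rows' hypotheses. -/
theorem xcell_C2aL197A6Q (M : NewformModel) (hP : M.BS04Package) (hQ : M.Q2Package)
    (hE : M.EisPackage)
    (hD197 : M.DataComplete 197 level197Orbits)
    (hD394 : M.DataComplete 394 level394Orbits)
    (hR_orbit_394_4 : M.Refines 394 orbit_394_4 m6X_394_4)
    (hQ2_orbit_197_1 : ∀ f : M.Form 197, M.Matches f orbit_197_1 → M.Matches f q2_197_1) :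
    Rows.C2aCellRed 197 (fun a => 6 ≤ a) ∅ :=
  C2aCellRed_of_rows 197 (by norm_num) (by norm_num) _ _
    (fun n hn h11 hnℓ _ a m ha han hm hmn x y z h1 h2 =>
      xrow_C2aL197A6Q M hP hQ hE hD197 hD394 hR_orbit_394_4 n hn h11 hnℓ a m ha hm han hmn hQ2_orbit_197_1 x y z h1 h2)
    (fun n hn h11 hnℓ _ a m ha han hm hmn x y z h1 h2 =>
      xrow_C2aL197A6QAB M hP hQ hE hD197 hD394 hR_orbit_394_4 n hn h11 hnℓ a m ha hm han hmn hQ2_orbit_197_1 x y z h1 h2)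

end Summit.Ventures.AbcSig
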